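import Summits.FinalStateConjecture.FinalStateConjecture.Theorems.EIHFluxBalanceInertialRecessionStubEndgameOracleCross

/-!
# Route EIHFluxBalance — crux `InertialRecession`, line `sublinear-is-free-clean-window-charges`:
# the ABSTRACT endgame modulo an INCREMENT ORACLE — the slow-group induction Λ(d)

Helper file for the crux `stmt-FinalStateConjecture-10166`
(`Summit.FinalStateConjecture.FinalStateConjecture.Theses.EIHFluxBalance.InertialRecession`), registered stub
`stub_pairwiseDichotomy` (lead reshape r7) of `Cruxes/InertialRecession/Lines/sublinear_is_free_clean_window_charges.lean`;
second file of the oracle series (see `…OracleCross`).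

`oracleSlowGroup` (Lemma Λ for the abstract charges, modulo the increment oracle at scale `Ω`): by induction on `d ≥ |G|`.
A nonempty group `G` with velocity spread `≤ θ` at `a₀ ≥ T` (`θ ≥ 24(N+d)θ_g Q^{d³+d}`) all of whose outsiders are ballistic on
`[a₀,u]` with floor `Qθ/2` keeps every member velocity within `12θ + 12dθ_g` of its initial value on `[a₀,u]`: until the first
time `t₁` at which the spread reaches `10θ`, the oracle (slowness `10θ ≤ 30·(Qθ/2)/Q`) bounds the increments of `Π_G`, `E_G` by `Ω`,
so the tracked velocity `V_G = Π_G/E_G` moves by `≤ 2Ω/m_min ≤ θ_g` (`norm_sub_clusterVelocity_of_increments`) and the wobble is at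
most the spread (`norm_sub_clusterVelocity_le`); at `t₁` split by the empty band (`exists_gap_finset`) and apply
`oracleCrossBootstrap` with the induction hypothesis.
-/

noncomputable section

set_option linter.dupNamespace false

open Filter Topology Set MeasureTheory
open scoped Topology BigOperators InnerProductSpace RealInnerProductSpace

namespace Summit.FinalStateConjecture.FinalStateConjecture.Theorems.SublinearIsFree.Oracle

open Literature.Geometry.Lorentzian
open Summit.FinalStateConjecture.FinalStateConjecture.Theorems.SublinearIsFree.Endgame
open Summit.FinalStateConjecture.FinalStateConjecture.Theorems.SublinearIsFree.Toy

set_option maxHeartbeats 800000 in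
/-- **LEMMA Λ (slow-group induction) for the abstract charges, modulo the increment oracle.** See the module docstring.
The oracle hypothesis `hOR` (at the fixed scale `Ω` with `2Ω ≤ m_min θ_g`): for every nonempty member set `S` on `[t₁,t₂] ⊆ [T,∞)`
whose internal speeds stay `≤ 30W/Q` and whose (member, outsider) pairs are ballistic with floor `W` (`W ≥ Qθ_g/2`), the momentum
`Σ_S Mⱼγⱼvⱼ` and the energy `Σ_S Mⱼγⱼ` change by at most `Ω`. [folklore] -/
theorem oracleSlowGroup {N : ℕ} {M : Fin N → ℝ} {ξ v : Fin N → ℝ → E3} {T k₀ mmin estar Q θg Ω : ℝ}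
    (hM : ∀ i, mmin ≤ M i) (hmmin : 0 < mmin) (hk₀ : k₀ < 1) (hvk : ∀ i t, ‖v i t‖ ≤ k₀)
    (hvc : ∀ i, Continuous (v i))
    (herr : ∀ i s, T ≤ s → ‖deriv (ξ i) s - v i s‖ ≤ estar)
    (hQ : 400 ≤ Q) (hθg : 0 < θg) (he : 16 * estar ≤ Q * θg) (hΩ : 2 * Ω ≤ mmin * θg)
    (hOR : ∀ (S : Finset (Fin N)) (t₁ t₂ W : ℝ), T ≤ t₁ → t₁ ≤ t₂ → Q * θg / 2 ≤ W → S.Nonempty →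
      (∀ s ∈ Icc t₁ t₂, ∀ k ∈ S, ∀ l ∈ S, ‖v k s - v l s‖ ≤ 30 * W / Q) →
      (∀ i ∈ S, ∀ j ∉ S, ∃ n : E3, ‖n‖ = 1 ∧ ∀ s ∈ Icc t₁ t₂, W / 2 ≤ ⟪deriv (ξ j) s - deriv (ξ i) s, n⟫) →
      ‖∑ j ∈ S, (M j * (√(1 - ‖v j t₂‖ ^ 2))⁻¹) • v j t₂ - ∑ j ∈ S, (M j * (√(1 - ‖v j t₁‖ ^ 2))⁻¹) • v j t₁‖ ≤ Ω ∧
      |∑ j ∈ S, M j * (√(1 - ‖v j t₂‖ ^ 2))⁻¹ - ∑ j ∈ S, M j * (√(1 - ‖v j t₁‖ ^ 2))⁻¹| ≤ Ω) :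
    ∀ (d : ℕ) (G : Finset (Fin N)), G.card ≤ d → G.Nonempty →
    ∀ (a₀ u θ : ℝ), T ≤ a₀ → a₀ ≤ u → 24 * (N + d) * θg * Q ^ (d ^ 3 + d) ≤ θ →
    (∀ k ∈ G, ∀ l ∈ G, ‖v k a₀ - v l a₀‖ ≤ θ) →
    (∀ i ∈ G, ∀ j ∉ G, ∃ n : E3, ‖n‖ = 1 ∧ ∀ s ∈ Icc a₀ u, Q * θ / 4 ≤ ⟪deriv (ξ j) s - deriv (ξ i) s, n⟫) →
    ∀ t ∈ Icc a₀ u, ∀ k ∈ G, ‖v k t - v k a₀‖ ≤ 12 * θ + 12 * d * θg := by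
  classical
  have hMpos : ∀ i, 0 < M i := fun i ↦ hmmin.trans_le (hM i)
  have hv1 : ∀ i t, ‖v i t‖ < 1 := fun i t ↦ (hvk i t).trans_lt hk₀
  have hQ0 : 0 < Q := by linarith
  intro d
  induction d with
  | zero =>
      intro G hG hGne
      exact absurd (Finset.card_pos.mpr hGne) (by omega)
  | succ d IH =>
    intro G hGcard hGne a₀ u θ ha₀ hau hθ hslow hout t ht k hk
    -- make the base `Q ^ _` opaque in the threshold
    generalize hPgen : Q ^ ((d + 1) ^ 3 + (d + 1)) = P at hθ
    have hP1 : 1 ≤ P := by rw [← hPgen]; exact one_le_pow₀ (by linarith)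
    -- basic sizes
    have hN1 : (1 : ℝ) ≤ N := by
      have : 0 < N := Fin.pos (hGne.choose)
      exact_mod_cast this
    have hθpos : 0 < θ := by
      have : 0 < 24 * ((N : ℝ) + (d + 1 : ℕ)) * θg * P := by positivity
      linarith
    have hθgθ : θg ≤ θ := by
      have h1 : 24 * ((N : ℝ) + (d + 1 : ℕ)) * θg ≤ 24 * ((N : ℝ) + (d + 1 : ℕ)) * θg * P :=
        le_mul_of_one_le_right (by positivity) hP1
      have hd0 : (0 : ℝ) ≤ (d + 1 : ℕ) := by positivity
      nlinarith
    -- the energy of `G` is at least `mmin`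
    have hEge : ∀ s, mmin ≤ ∑ j ∈ G, M j * (√(1 - ‖v j s‖ ^ 2))⁻¹ := by
      intro s
      obtain ⟨i₀, hi₀⟩ := hGne
      calc mmin ≤ M i₀ := hM i₀
        _ ≤ M i₀ * (√(1 - ‖v i₀ s‖ ^ 2))⁻¹ := mass_le_energy (hMpos i₀) (hv1 i₀ s)
        _ ≤ ∑ j ∈ G, M j * (√(1 - ‖v j s‖ ^ 2))⁻¹ :=
            Finset.single_le_sum (fun j _ ↦ (mul_pos (hMpos j)
              (lt_of_lt_of_le one_pos (one_le_inv_sqrt_one_sub_sq (hv1 j s)))).le) hi₀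
    have hEpos : ∀ s, 0 < ∑ j ∈ G, M j * (√(1 - ‖v j s‖ ^ 2))⁻¹ := fun s ↦ hmmin.trans_le (hEge s)
    -- PHASE 1: drift bound wherever the spread has stayed `≤ 10θ`
    have phase1 : ∀ s ∈ Icc a₀ u, (∀ s' ∈ Icc a₀ s, ∀ k ∈ G, ∀ l ∈ G, ‖v k s' - v l s'‖ ≤ 10 * θ) →
        ∀ k ∈ G, ‖v k s - v k a₀‖ ≤ 11 * θ + θg := by
      intro s hs hsp k hk
      set E : ℝ → ℝ := fun σ ↦ ∑ j ∈ G, M j * (√(1 - ‖v j σ‖ ^ 2))⁻¹ with hE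
      set P₀ : ℝ → E3 := fun σ ↦ ∑ j ∈ G, (M j * (√(1 - ‖v j σ‖ ^ 2))⁻¹) • v j σ with hP₀
      set V : ℝ → E3 := fun σ ↦ (E σ)⁻¹ • P₀ σ with hV
      have hw1 : ‖v k s - V s‖ ≤ 10 * θ :=
        norm_sub_clusterVelocity_le G M (fun i ↦ v i s) hk hMpos (fun i ↦ hv1 i s)
          fun l hl ↦ hsp s ⟨hs.1, le_rfl⟩ k hk l hl
      have hw0 : ‖v k a₀ - V a₀‖ ≤ θ :=
        norm_sub_clusterVelocity_le G M (fun i ↦ v i a₀) hk hMpos (fun i ↦ hv1 i a₀) fun l hl ↦ hslow k hk l hl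
      -- the oracle on `[a₀, s]` with floor `W = Qθ/2`
      have hor := hOR G a₀ s (Q * θ / 2) ha₀ hs.1 (by nlinarith) ⟨k, hk⟩
        (fun s' hs' k' hk' l' hl' ↦ by
          have := hsp s' hs' k' hk' l' hl'
          have hid : 30 * (Q * θ / 2) / Q = 15 * θ := by field_simp; ring
          rw [hid]; linarith)
        (fun i hi j hj ↦ by
          obtain ⟨n, hn, hb⟩ := hout i hi j hj
          exact ⟨n, hn, fun s' hs' ↦ by have := hb s' ⟨hs'.1, hs'.2.trans hs.2⟩; linarith⟩)
      have hVV : ‖V s - V a₀‖ ≤ θg := by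
        have h1 : ‖P₀ a₀‖ ≤ E a₀ :=
          norm_clusterMomentum_le_energy G (fun j ↦ M j * (√(1 - ‖v j a₀‖ ^ 2))⁻¹) (fun j ↦ v j a₀)
            (fun j ↦ (mul_pos (hMpos j) (lt_of_lt_of_le one_pos (one_le_inv_sqrt_one_sub_sq (hv1 j a₀)))).le)
            (fun j ↦ (hv1 j a₀).le)
        have h2 := norm_sub_clusterVelocity_of_increments (P₂ := P₀ s) h1 (hEpos a₀) hmmin (hEge s)
        calc ‖V s - V a₀‖ ≤ (‖P₀ s - P₀ a₀‖ + |E s - E a₀|) / mmin := h2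
          _ ≤ (Ω + Ω) / mmin := by gcongr; exacts [hor.1, hor.2]
          _ ≤ θg := by rw [div_le_iff₀ hmmin]; linarith
      calc ‖v k s - v k a₀‖ = ‖(v k s - V s) + (V s - V a₀) - (v k a₀ - V a₀)‖ := by abel_nf
        _ ≤ ‖v k s - V s‖ + ‖V s - V a₀‖ + ‖v k a₀ - V a₀‖ := norm_sub_le_of_le (norm_add_le _ _) le_rfl
        _ ≤ 11 * θ + θg := by linarith
    -- the bad set and the splitting time
    set BAD : Set ℝ := {s | s ∈ Icc a₀ u ∧ ∃ k ∈ G, ∃ l ∈ G, 10 * θ < ‖v k s - v l s‖} with hBAD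
    by_cases hBADne : ¬ BAD.Nonempty
    · have hsp : ∀ s ∈ Icc a₀ u, ∀ k ∈ G, ∀ l ∈ G, ‖v k s - v l s‖ ≤ 10 * θ := by
        intro s hs k hk l hl
        by_contra h
        exact hBADne ⟨s, hs, k, hk, l, hl, not_le.mp h⟩
      have h1 := phase1 t ht (fun s' hs' ↦ hsp s' ⟨hs'.1, hs'.2.trans ht.2⟩) k hk
      have hd0 : 0 ≤ (d : ℝ) * θg := by positivity
      rw [Nat.cast_succ]
      linarith only [h1, hd0, hθpos, hθg]
    push Not at hBADne
    have hBADbdd : BddBelow BAD := ⟨a₀, fun s hs ↦ hs.1.1⟩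
    set t₁ : ℝ := sInf BAD with ht₁
    have hat₁ : a₀ ≤ t₁ := le_csInf hBADne fun s hs ↦ hs.1.1
    have ht₁u : t₁ ≤ u := by
      obtain ⟨s, hs⟩ := hBADne
      exact (csInf_le hBADbdd hs).trans hs.1.2
    have hTt₁ : T ≤ t₁ := ha₀.trans hat₁
    have hsp_lt : ∀ s ∈ Ico a₀ t₁, ∀ k ∈ G, ∀ l ∈ G, ‖v k s - v l s‖ ≤ 10 * θ := by
      intro s hs k hk l hl
      by_contra h
      have : t₁ ≤ s := csInf_le hBADbdd ⟨⟨hs.1, hs.2.le.trans ht₁u⟩, k, hk, l, hl, not_le.mp h⟩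
      exact absurd this (not_le.mpr hs.2)
    have hsp_t₁ : ∀ k ∈ G, ∀ l ∈ G, ‖v k t₁ - v l t₁‖ ≤ 10 * θ := by
      intro k hk l hl
      rcases eq_or_lt_of_le hat₁ with h | h
      · rw [← h]; linarith [hslow k hk l hl]
      · have hc : Continuous fun s ↦ ‖v k s - v l s‖ := ((hvc k).sub (hvc l)).norm
        have htend : Tendsto (fun s ↦ ‖v k s - v l s‖) (𝓝[<] t₁) (𝓝 ‖v k t₁ - v l t₁‖) :=
          hc.continuousAt.tendsto.mono_left nhdsWithin_le_nhds
        exact le_of_tendsto htend (mem_of_superset (Ico_mem_nhdsLT h) fun s hs ↦ hsp_lt s hs k hk l hl)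
    have hsp_le : ∀ s ∈ Icc a₀ t₁, ∀ k ∈ G, ∀ l ∈ G, ‖v k s - v l s‖ ≤ 10 * θ := by
      intro s hs k hk l hl
      rcases eq_or_lt_of_le hs.2 with h | h
      · rw [h]; exact hsp_t₁ k hk l hl
      · exact hsp_lt s ⟨hs.1, h⟩ k hk l hl
    obtain ⟨k₁, hk₁, l₁, hl₁, hkl₁⟩ : ∃ k₁ ∈ G, ∃ l₁ ∈ G, 10 * θ ≤ ‖v k₁ t₁ - v l₁ t₁‖ := by
      by_contra hno
      push Not at hno
      have hnear : ∀ᶠ s in 𝓝 t₁, ∀ p ∈ G ×ˢ G, ‖v p.1 s - v p.2 s‖ < 10 * θ := by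
        rw [Filter.eventually_all_finset]
        intro p hp
        have hp' := Finset.mem_product.mp hp
        exact (((hvc p.1).sub (hvc p.2)).norm).continuousAt.eventually_lt continuousAt_const (hno p.1 hp'.1 p.2 hp'.2)
      obtain ⟨δ, hδ, hball⟩ := Metric.eventually_nhds_iff.mp hnear
      have hcontra : t₁ + δ ≤ t₁ := by
        rw [ht₁]
        refine le_csInf hBADne fun b hb ↦ ?_
        by_contra hlt
        push Not at hlt
        have hb1 : sInf BAD ≤ b := csInf_le hBADbdd hb
        have hdist : dist b (sInf BAD) < δ := by
          rw [Real.dist_eq, abs_of_nonneg (by linarith)]; linarith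
        obtain ⟨k', hk', l', hl', hkl'⟩ := hb.2
        have := hball hdist (k', l') (Finset.mem_product.mpr ⟨hk', hl'⟩)
        exact absurd this (not_lt.mpr hkl'.le)
      linarith
    -- PHASE 1 conclusion (also settles `t ≤ t₁`)
    have hdrift1 : ∀ s ∈ Icc a₀ t₁, ∀ k ∈ G, ‖v k s - v k a₀‖ ≤ 11 * θ + θg := fun s hs k hk ↦
      phase1 s ⟨hs.1, hs.2.trans ht₁u⟩ (fun s' hs' ↦ hsp_le s' ⟨hs'.1, hs'.2.trans hs.2⟩) k hk
    by_cases htt₁ : t ≤ t₁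
    · have h1 := hdrift1 t ⟨ht.1, htt₁⟩ k hk
      have hd0 : 0 ≤ (d : ℝ) * θg := by positivity
      rw [Nat.cast_succ]
      linarith only [h1, hd0, hθpos, hθg]
    push Not at htt₁
    -- PHASE 2: split `G` at `t₁` by the empty band of its velocity configuration
    have hQ2 : (2 : ℝ) ≤ Q := by linarith
    obtain ⟨θ', hθ'lo, hθ'hi, hθ'pos, hdich, htrans⟩ :=
      exists_gap_finset G (fun i ↦ v i t₁) (by positivity : (0 : ℝ) < 10 * θ) hQ2
    have hθ'le : θ' ≤ θ / 40 := by
      have h1 : 10 * θ / Q ≤ 10 * θ / 400 := div_le_div_of_nonneg_left (by positivity) (by norm_num) hQ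
      linarith
    -- the level threshold for the sub-classes
    have hθ'ge : 24 * (N + d) * θg * Q ^ (d ^ 3 + d) ≤ θ' := by
      set e : ℕ := (d + 1) ^ 2 + 1 with he_def
      have hQe : 0 < Q ^ e := pow_pos hQ0 e
      have h1 : 10 * θ / Q ^ e ≤ θ' := by
        refine le_trans ?_ hθ'lo
        refine div_le_div_of_nonneg_left (by positivity) (pow_pos hQ0 _) ?_
        refine pow_le_pow_right₀ (by linarith) ?_
        have : G.card * G.card ≤ (d + 1) * (d + 1) := Nat.mul_le_mul hGcard hGcard
        have h' : (d + 1) * (d + 1) = (d + 1) ^ 2 := (sq (d + 1)).symm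
        rw [he_def]; omega
      have hexp : Q ^ (d ^ 3 + d) * Q ^ e ≤ P := by
        rw [← pow_add, ← hPgen]
        exact pow_le_pow_right₀ (by linarith) (level_exponent_le d)
      have hcoef : 24 * ((N : ℝ) + d) * θg ≤ 24 * (N + (d + 1 : ℕ)) * θg := by
        have hd1 : ((d + 1 : ℕ) : ℝ) = (d : ℝ) + 1 := Nat.cast_succ d
        have h' : (N : ℝ) + d ≤ N + (d + 1 : ℕ) := by rw [hd1]; linarith only
        exact mul_le_mul_of_nonneg_right (mul_le_mul_of_nonneg_left h' (by norm_num)) hθg.le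
      have hc0 : 0 ≤ 24 * ((N : ℝ) + d) * θg := by positivity
      have h2 : 24 * (N + d) * θg * Q ^ (d ^ 3 + d) * Q ^ e ≤ θ := by
        calc 24 * (N + d) * θg * Q ^ (d ^ 3 + d) * Q ^ e
            = 24 * (N + d) * θg * (Q ^ (d ^ 3 + d) * Q ^ e) := by rw [mul_assoc]
          _ ≤ 24 * (N + d) * θg * P := mul_le_mul_of_nonneg_left hexp hc0
          _ ≤ 24 * (N + (d + 1 : ℕ)) * θg * P := mul_le_mul_of_nonneg_right hcoef (by linarith)
          _ ≤ θ := hθ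
      rw [← le_div_iff₀ hQe] at h2
      have h3 : θ / Q ^ e ≤ 10 * θ / Q ^ e := by
        rw [div_le_div_iff_of_pos_right hQe]; linarith only [hθpos]
      linarith only [h1, h2, h3]
    -- classes are proper: the realised pair `k₁, l₁` is split
    have hcls_card : ∀ k ∈ G, (G.filter fun l ↦ ‖v k t₁ - v l t₁‖ < θ').card ≤ d := by
      intro k hk
      set C : Finset (Fin N) := G.filter fun l ↦ ‖v k t₁ - v l t₁‖ < θ' with hC
      have hcls_slow : ∀ k' ∈ C, ∀ l' ∈ C, ‖v k' t₁ - v l' t₁‖ < θ' := by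
        intro k' hk' l' hl'
        have h1 := (Finset.mem_filter.mp hk')
        have h2 := (Finset.mem_filter.mp hl')
        have h1' : ‖v k' t₁ - v k t₁‖ < θ' := by rw [norm_sub_rev]; exact h1.2
        exact htrans k' h1.1 k hk l' h2.1 h1' h2.2
      have hout : k₁ ∉ C ∨ l₁ ∉ C := by
        by_contra h
        push Not at h
        have := hcls_slow k₁ h.1 l₁ h.2
        linarith
      have hsub : C ⊆ G := Finset.filter_subset _ _
      have hss : C ⊂ G := by
        rcases hout with h | h
        · exact Finset.ssubset_iff_subset_ne.mpr ⟨hsub, fun he ↦ h (he ▸ hk₁)⟩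
        · exact Finset.ssubset_iff_subset_ne.mpr ⟨hsub, fun he ↦ h (he ▸ hl₁)⟩
      have := Finset.card_lt_card hss
      omega
    -- outsiders of `G` stay ballistic on `[t₁, u]` with the smaller floor `Qθ'/2`
    have hout' : ∀ i ∈ G, ∀ j ∉ G, ∃ n : E3, ‖n‖ = 1 ∧
        ∀ s ∈ Icc t₁ u, Q * θ' / 4 ≤ ⟪deriv (ξ j) s - deriv (ξ i) s, n⟫ := by
      intro i hi j hj
      obtain ⟨n, hn, hb⟩ := hout i hi j hj
      refine ⟨n, hn, fun s hs ↦ ?_⟩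
      have := hb s ⟨hat₁.trans hs.1, hs.2⟩
      have : Q * θ' ≤ Q * θ := mul_le_mul_of_nonneg_left (by linarith) hQ0.le
      linarith
    have hdrift2 : ‖v k t - v k t₁‖ ≤ 12 * θ' + 12 * d * θg :=
      oracleCrossBootstrap hvc herr hQ hθg he IH hTt₁ ht₁u hθ'pos hdich htrans hθ'ge hcls_card hout'
        k hk t ⟨htt₁.le, ht.2⟩
    -- combine the two phases
    have h1 := hdrift1 t₁ ⟨hat₁, le_rfl⟩ k hk
    calc ‖v k t - v k a₀‖ = ‖(v k t - v k t₁) + (v k t₁ - v k a₀)‖ := by abel_nf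
      _ ≤ ‖v k t - v k t₁‖ + ‖v k t₁ - v k a₀‖ := norm_add_le _ _
      _ ≤ (12 * θ' + 12 * d * θg) + (11 * θ + θg) := add_le_add hdrift2 h1
      _ ≤ 12 * θ + 12 * (d + 1 : ℕ) * θg := by
          rw [Nat.cast_succ]
          have hd0 : 0 ≤ (d : ℝ) * θg := by positivity
          linarith only [hθ'le, hd0, hθg, hθpos]

/-- Registered helper form of `norm_sub_clusterVelocity_of_increments` (carrier of this file). [folklore] -/
theorem oracle_clusterVelocity_of_increments : ∀ (P₁ P₂ : E3) (E₁ E₂ Mtot : ℝ), ‖P₁‖ ≤ E₁ → 0 < E₁ → 0 < Mtot → Mtot ≤ E₂ → ‖E₂⁻¹ • P₂ - E₁⁻¹ • P₁‖ ≤ (‖P₂ - P₁‖ + |E₂ - E₁|) / Mtot :=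
  fun _ _ _ _ _ h1 hE₁ hM hE₂ ↦ norm_sub_clusterVelocity_of_increments h1 hE₁ hM hE₂

end Summit.FinalStateConjecture.FinalStateConjecture.Theorems.SublinearIsFree.Oracle

end
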